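import Mathlib
import Summits.NavierStokesRegularity.NavierStokesRegularity.Theorems.ScaledTopAlignmentFlexibleZoomLU
import Summits.NavierStokesRegularity.NavierStokesRegularity.Theorems.ScaledTopAlignmentMostTimesEnd
import Summits.NavierStokesRegularity.NavierStokesRegularity.Theorems.LocalSineTubeDoorProfileAlignedWindowRigidity
import Summits.NavierStokesRegularity.NavierStokesRegularity.Theorems.ClockStretchingLawClockCeilingSingularStretchingNearZero
import Summits.NavierStokesRegularity.NavierStokesRegularity.Theorems.ScaledTopAlignmentDirectionGradientLaLbTools
import Literature.Analysis.FunctionSpaces.MorreyConvexDomain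
import Literature.Analysis.FluidPDE.VorticityCalculus
import HarnessLib

/-!
# Route `ScaledTopAlignment`: the scaling-invariant `L^a(L^b)` direction-gradient criterion under
# Type I (Giga–Miura 2011, Rmk. 2.8: `2/a + 3/b = 1`, `2 < a < ∞`) — PROVED in the tree's Leray–Hopf
# frame (support for the deciding crux W3ᵐᵗ = `AprioriMostTimesBulkAlignment`,
# stmt-NavierStokesRegularity-19551; no import of the route file)

Source: Y. Giga, H. Miura, Comm. Math. Phys. **303** (2011) 289–300 [GigaMiura2011] = HUPS #956
(render `run/shared/lean/pub/ns-regularity-ideate/ns-regularity-ideate-lit/renders/GM11-HokkaidoPreprint956-full/`),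
p. 9 Cor. 2.6 (tree: `ScaledTopAlignmentGigaMiuraDirectionGradient`) and p. 10, Rmk. 2.8 (verbatim
up to notation): "In [BB], regularity of a weak solution of (NS) is established under the assumption
that `∫_{−1}^{0} ‖∇ζ‖^a_{L^b(Ω_d(t))}(t) dt < +∞` for `2/a + 3/b = 1/2`. This assumption is not
scaling invariant while ours is scaling invariant. It is easy to generalize our assumption in this
form with `2/a + 3/b = 1` and `2 ≤ a < ∞`." This module proves that generalisation for
`2 < a < ∞`, `3 < b < ∞`; the endpoint `(a, b) = (2, ∞)` is Cor. 2.6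
(`hasSmoothExtensionPast_of_directionGradient_sqIntegrable_typeI`). For `b < ∞` the spatial norm is
an INTEGRAL over the top region — a BULK condition tolerating large `∇ξ` on small sets — and the
time norm is an integral too: among printed direction criteria this family is the closest analogue
of the route's bulk, most-times door W3ᵐᵗ (stmt-19551).

Proof (`false_of_directionGradient_LaLb_typeI`) = the proof of Cor. 2.6 with Morrey's inequality in
place of the mean-value inequality: flexible Type-I zoom with locally uniform slice convergence
(`typeIZoom_ancientMild_limit_flexible_locUnif`) and a non-unidirectional end
(`exists_end_curl_not_unidirectional`); scaling — on a ball whose zoom preimage lies in `Ω_d(t)` the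
zoomed direction field `ζ_j = ξ(t_j, x_j + λ_j ·)` has `‖∇ζ_j‖_{L^b(B)} ≤ λ_j^{1−3/b} G(t_j)` (chain
rule + `setLIntegral_ball_comp_add_smul_le`) and `(λ_j^{1−3/b} G)^a = λ_j² G^a` BECAUSE
`a(1 − 3/b) = 2`, so `exists_slice_frequently_lt_of_integrable` (Fatou on the tail of `∫ G^a`) gives a
slice `s₀` with `λ_j^{1−3/b} G(t_j(s₀)) < η` frequently; Morrey on the ball
(`Literature.Analysis.FunctionSpaces.morrey_holder_of_convex`, `b > 3 = dim`) makes the limit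
direction constant there; LocalSineTubeDoor's `eq_zero_of_aligned_window` kills the limit.
WHAT THIS IS NOT: not NS regularity — a Type-I-CONDITIONAL criterion (a remark of the source made
into a theorem); it does not prove W3ᵐᵗ and leaves the residual NoTypeII (stmt-0056) untouched.

## References
* Y. Giga, H. Miura, Comm. Math. Phys. 303 (2011) 289–300 = HUPS #956: Cor. 2.6, Rmk. 2.7–2.8
  (pp. 9–10). [GigaMiura2011]
* R. A. Adams, *Sobolev Spaces* (1975), Lemma 5.17 (Morrey's inequality on convex cells). [Adams1975]
-/

noncomputable section

-- the summit and its single sub-problem share the name (CONVENTIONS §1), as in every Theorems file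
set_option linter.dupNamespace false

open MeasureTheory Set Function Filter Topology Metric
open scoped RealInnerProductSpace ENNReal NNReal

namespace Summit.NavierStokesRegularity.NavierStokesRegularity.Theorems

open Literature.Analysis Literature.Analysis.FluidPDE
open Summit.NavierStokesRegularity.NavierStokesRegularity.Theorems.LocalSineTubeDoorProfileAlignedWindowRigidity

set_option maxHeartbeats 1600000 in
/-- **An `L^a(0,T; L^b(Ω_d))` bound on `∇ξ`, `2/a + 3/b = 1`, `3 < b < ∞`, kills Type-I blow-up**
(blow-up form of Giga–Miura 2011, Rmk. 2.8). Let `(u, p)` be a classical solution on `ℝ³ × [0, T)`,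
Leray–Hopf from `u 0`, bounded on every `[0, T'] × ℝ³` (`T' < T`), with the Type-I rate at `T` and no
smooth extension past `T`; let `d > 0`, `3 < b < ∞`, `2/a + 3/b = 1`, and let `G : ℝ → [0,∞]` be
measurable with `∫_{(0,T)} G^a < ∞` and `‖D(ξ(t))‖_{L^b(Ω_d(t))} ≤ G t` for `t ∈ (0,T)`
(`Ω_d(t) = {x : |ω(t,x)| > d}`, `ξ = vorticityDirection (curl (u t))`). Then `False`.
[cite: GigaMiura2011, Rmk. 2.8 with Cor. 2.6 / Rmk. 2.7 (§2.1; HUPS preprint #956 pp. 9–10)] -/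
theorem false_of_directionGradient_LaLb_typeI {ν T : ℝ} (hν : 0 < ν) (hT : 0 < T)
    {u : ℝ → EuclideanSpace ℝ (Fin 3) → EuclideanSpace ℝ (Fin 3)}
    {p : ℝ → EuclideanSpace ℝ (Fin 3) → ℝ}
    (hsol : IsClassicalNSSolutionOn (Ico 0 T) ν 0 u p) (hLH : IsLerayHopfOn T ν 0 (u 0) u)
    (hslab : ∀ T' < T, ∃ M : ℝ, ∀ t ∈ Icc 0 T', ∀ x, ‖u t x‖ ≤ M)
    (hI : IsTypeIBlowup u T) (hext : ¬ HasSmoothExtensionPast ν 0 u T)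
    {d : ℝ} (hd : 0 < d) {a : ℝ} {b : ℝ≥0} (hb3 : 3 < (b : ℝ)) (hab : 2 / a + 3 / (b : ℝ) = 1)
    {G : ℝ → ℝ≥0∞} (hGm : Measurable G) (hGa : (∫⁻ t in Ioo 0 T, G t ^ a) < ∞)
    (hDξ : ∀ t ∈ Ioo 0 T, eLpNorm (fderiv ℝ (vorticityDirection (curl (u t)))) (b : ℝ≥0∞)
      (volume.restrict {x | d < ‖curl (u t) x‖}) ≤ G t) : False := by
  -- exponents: `γ = 1 - 3/b ∈ (0, 1)`, `a γ = 2`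
  have hb0 : (0 : ℝ) < b := by linarith
  set γ : ℝ := 1 - 3 / (b : ℝ) with hγdef
  have hγ0 : 0 < γ := by
    rw [hγdef, sub_pos, div_lt_one hb0]; exact hb3
  have haγ : 2 / a = γ := by rw [hγdef]; linarith
  have hapos : 0 < a := by
    by_contra hle; push Not at hle
    linarith [div_nonpos_of_nonneg_of_nonpos (by norm_num : (0 : ℝ) ≤ 2) hle]
  have hγa : γ * a = 2 := by rw [← haγ]; field_simp
  have hbγ : (b : ℝ) * γ = (b : ℝ) - 3 := by rw [hγdef]; field_simp
  have hb1 : (1 : ℝ≥0) ≤ b := by exact_mod_cast (show (1 : ℝ) ≤ (b : ℝ) by linarith)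
  have hbne0 : ((b : ℝ≥0) : ℝ≥0∞) ≠ 0 := by
    exact_mod_cast (show (b : ℝ≥0) ≠ 0 from fun h => by rw [h] at hb0; simp at hb0)
  have hbtop : ((b : ℝ≥0) : ℝ≥0∞) ≠ ⊤ := ENNReal.coe_ne_top
  have hbreal : ((b : ℝ≥0) : ℝ≥0∞).toReal = (b : ℝ) := ENNReal.coe_toReal b
  classical
  -- Step 1: the flexible zoom with locally uniform slice convergence, base times `τ_j = T - T/(j+2)`
  set τ : ℕ → ℝ := fun j => T - T / ((j : ℝ) + 2) with hτdef
  have hτ : ∀ j, τ j ∈ Ico 0 T := fun j => by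
    have h2 : (0 : ℝ) < (j : ℝ) + 2 := by positivity
    have h3 : T / ((j : ℝ) + 2) ≤ T := div_le_self hT.le (by linarith)
    have h4 : 0 < T / ((j : ℝ) + 2) := div_pos hT h2
    simp only [hτdef, mem_Ico]
    constructor <;> linarith
  have hτT : Tendsto τ atTop (𝓝 T) := by
    have h1 : Tendsto (fun j : ℕ => T / ((j : ℝ) + 2)) atTop (𝓝 0) :=
      tendsto_const_nhds.div_atTop (tendsto_atTop_add_const_right _ _ tendsto_natCast_atTop_atTop)
    have h2 := h1.const_sub T
    rw [sub_zero] at h2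
    exact h2
  obtain ⟨φ, -, C, W, xc, lam, hWcl, hW0, hlam, -, hlam0, -, hflex, hLU⟩ :=
    typeIZoom_ancientMild_limit_flexible_locUnif hν hT hsol hLH hslab hI hext hτ hτT
  have hc : ∀ j, 0 < lam j ^ 2 / ν := fun j => div_pos (pow_pos (hlam j) 2) hν
  have hc0 : Tendsto (fun j => lam j ^ 2 / ν) atTop (𝓝 0) := by
    have h := (hlam0.pow 2).div_const ν
    rw [zero_pow two_ne_zero, zero_div] at h
    exact h
  -- Step 2: a non-unidirectional vorticity end `s < t₁` of `W`
  obtain ⟨t₁, ht₁, hend⟩ := exists_end_curl_not_unidirectional hWcl ⟨-1, by norm_num, 0, hW0⟩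
  have hnz : ∀ s < t₁, ∃ y, curl (W s) y ≠ 0 := fun s hs => by
    by_contra h
    push Not at h
    refine hend s hs ⟨EuclideanSpace.single 0 1, fun h0 => ?_, fun y => ⟨0, by rw [h y, zero_smul]⟩⟩
    simpa using congr_arg (fun v : EuclideanSpace ℝ (Fin 3) => v 0) h0
  -- Step 3: an a.e.-good slice `s₀ ∈ (t₁ - 1, t₁)`: `λ_j² G(T + λ_j² s₀/ν)^a < ε` frequently in `j`,
  -- for every `ε > 0` (Fatou on the tail of `∫ G^a`, `exists_slice_frequently_lt_of_integrable`)
  have hΦm : Measurable fun t => G t ^ a := (ENNReal.continuous_rpow_const.measurable).comp hGm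
  obtain ⟨s₀, hs₀mem, hfreq⟩ := exists_slice_frequently_lt_of_integrable (T := T) hν hT hΦm hGa hlam
    hlam0 (show t₁ - 1 < t₁ by linarith) ht₁
  have hs₀t₁ : s₀ < t₁ := hs₀mem.2
  have hs₀0 : s₀ < 0 := hs₀t₁.trans ht₁
  -- the scaled majorant `Q j = λ_j^γ G(t_j)` and its `a`-th power `λ_j² G(t_j)^a`
  set Q : ℕ → ℝ≥0∞ := fun j => ENNReal.ofReal (lam j ^ γ) * G (T + lam j ^ 2 / ν * s₀) with hQdef
  have hQa : ∀ j, Q j ^ a = ENNReal.ofReal (lam j) ^ 2 * G (T + lam j ^ 2 / ν * s₀) ^ a := by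
    intro j
    simp only [hQdef]
    rw [ENNReal.mul_rpow_of_nonneg _ _ hapos.le,
      ENNReal.ofReal_rpow_of_nonneg (Real.rpow_nonneg (hlam j).le γ) hapos.le,
      ← Real.rpow_mul (hlam j).le, hγa, ← ENNReal.ofReal_pow (hlam j).le]
    norm_num
  have hfreqQ : ∀ η : ℝ, 0 < η → ∃ᶠ j in atTop, Q j < ENNReal.ofReal η := by
    intro η hη
    have hε : (0 : ℝ≥0∞) < ENNReal.ofReal η ^ a := ENNReal.rpow_pos (ENNReal.ofReal_pos.2 hη) ENNReal.ofReal_ne_top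
    refine (hfreq _ hε).mono fun j hj => ?_
    rw [← hQa j] at hj
    by_contra hle
    exact absurd hj (not_lt.2 (ENNReal.rpow_le_rpow (not_lt.1 hle) hapos.le))
  -- Step 4: the slice `s₀`: a ball on which the limit vorticity stays away from zero
  set Ω : EuclideanSpace ℝ (Fin 3) → EuclideanSpace ℝ (Fin 3) := curl (W s₀) with hΩdef
  obtain ⟨y₀, hy₀⟩ := hnz s₀ hs₀t₁
  have hΩc : Continuous Ω :=
    continuous_curl ((hWcl.contDiff_slice hs₀0).of_le (by exact_mod_cast le_top))
  set m₀ : ℝ := ‖Ω y₀‖ with hm₀def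
  have hm₀ : 0 < m₀ := norm_pos_iff.2 hy₀
  obtain ⟨r, hr, hball⟩ : ∃ r : ℝ, 0 < r ∧ ∀ y ∈ closedBall y₀ r, ‖Ω y - Ω y₀‖ < m₀ / 4 := by
    obtain ⟨δ, hδ, hδ'⟩ := Metric.continuousAt_iff.1 hΩc.continuousAt (m₀ / 4) (by positivity)
    refine ⟨δ / 2, by positivity, fun y hy => ?_⟩
    rw [← dist_eq_norm]
    exact hδ' (lt_of_le_of_lt (mem_closedBall.1 hy) (by linarith))
  have hΩne : ∀ y ∈ closedBall y₀ r, 3 * m₀ / 4 < ‖Ω y‖ := fun y hy => by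
    have h2 : ‖Ω y₀‖ - ‖Ω y‖ ≤ ‖Ω y - Ω y₀‖ := by
      rw [← norm_neg (Ω y - Ω y₀), neg_sub]; exact norm_sub_norm_le _ _
    linarith [hball y hy]
  have hΩne' : ∀ y ∈ closedBall y₀ r, Ω y ≠ 0 := fun y hy => norm_pos_iff.1 (by linarith [hΩne y hy])
  -- the vorticity zooms on the slice `s₀`, the physical times and the zoomed direction fields
  set F : ℕ → EuclideanSpace ℝ (Fin 3) → EuclideanSpace ℝ (Fin 3) := fun j y =>
    (lam j ^ 2 / ν) • curl (u (T + lam j ^ 2 * s₀ / ν)) (xc j + lam j • y) with hFdef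
  set tt : ℕ → ℝ := fun j => T + lam j ^ 2 * s₀ / ν with httdef
  have htt : ∀ j, T + lam j ^ 2 / ν * s₀ = tt j := fun j => by rw [httdef]; ring
  set ζ : ℕ → EuclideanSpace ℝ (Fin 3) → EuclideanSpace ℝ (Fin 3) := fun j y =>
    vorticityDirection (curl (u (tt j))) (xc j + lam j • y) with hζdef
  have hU : TendstoUniformlyOn F Ω atTop (closedBall y₀ r) :=
    (tendstoLocallyUniformly_iff_forall_isCompact.1 (hLU s₀ hs₀0)) _ (isCompact_closedBall _ _)
  have hev1 : ∀ᶠ j in atTop, ∀ y ∈ closedBall y₀ r, m₀ / 2 < ‖F j y‖ := by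
    filter_upwards [Metric.tendstoUniformlyOn_iff.1 hU (m₀ / 4) (by positivity)] with j hj y hy
    have h1 := hj y hy
    rw [dist_eq_norm] at h1
    have h3 : ‖Ω y‖ ≤ ‖Ω y - F j y‖ + ‖F j y‖ := by
      calc ‖Ω y‖ = ‖(Ω y - F j y) + F j y‖ := by rw [sub_add_cancel]
        _ ≤ ‖Ω y - F j y‖ + ‖F j y‖ := norm_add_le _ _
    linarith [hΩne y hy]
  have hev2 : ∀ᶠ j in atTop, lam j ^ 2 / ν * d < m₀ / 2 := by
    have h1 : Tendsto (fun j => lam j ^ 2 / ν * d) atTop (𝓝 (0 * d)) := hc0.mul_const d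
    rw [zero_mul] at h1
    exact h1.eventually_lt_const (by positivity)
  have hev3 : ∀ᶠ j in atTop, tt j ∈ Ioo 0 T := by
    have h1 : Tendsto (fun j => lam j ^ 2 / ν * (-s₀)) atTop (𝓝 (0 * (-s₀))) := hc0.mul_const _
    rw [zero_mul] at h1
    filter_upwards [h1.eventually_lt_const hT] with j hj
    have h2 : lam j ^ 2 / ν * s₀ < 0 := mul_neg_of_pos_of_neg (hc j) hs₀0
    rw [← htt j]
    exact ⟨by linarith, by linarith⟩
  -- Step 5: Morrey's inequality on the ball `B(y₀, r)` (`b > 3 = dim`), constant `Cm` independent of `j`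
  have hfr : (Module.finrank ℝ (EuclideanSpace ℝ (Fin 3)) : ℝ) < (b : ℝ) := by
    rw [finrank_euclideanSpace_fin]; push_cast; linarith
  obtain ⟨Cm, hCm, hMor⟩ := Literature.Analysis.FunctionSpaces.morrey_holder_of_convex
    (volume : Measure (EuclideanSpace ℝ (Fin 3))) (F := EuclideanSpace ℝ (Fin 3)) hb1 hfr isOpen_ball
    (convex_ball y₀ r) hr (Subset.refl (ball y₀ r)) (Subset.refl (ball y₀ r))
  -- the real constant of the final estimate
  set K : ℝ := (Cm * ENNReal.ofReal r ^ γ).toReal with hKdef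
  have hK0 : 0 ≤ K := ENNReal.toReal_nonneg
  have hgood : ∀ᶠ j in atTop, ∀ η : ℝ, 0 < η → Q j < ENNReal.ofReal η →
      ∀ y ∈ ball y₀ r, ‖ζ j y - ζ j y₀‖ ≤ η * K := by
    filter_upwards [hev1, hev2, hev3] with j h1 h2 h3 η hη hQ y hy
    -- the closed ball's preimage lies in the top region `Ω_d(tt j)`
    have htop : ∀ z ∈ closedBall y₀ r, d < ‖curl (u (tt j)) (xc j + lam j • z)‖ := by
      intro z hz
      have hF := h1 z hz
      have e : ‖F j z‖ = lam j ^ 2 / ν * ‖curl (u (tt j)) (xc j + lam j • z)‖ := by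
        simp only [hFdef, httdef]
        rw [norm_smul, Real.norm_of_nonneg (hc j).le]
      rw [e] at hF
      exact lt_of_mul_lt_mul_left (h2.trans hF) (hc j).le
    have hmem : tt j ∈ Ico 0 T := ⟨h3.1.le, h3.2⟩
    -- smoothness of `ξ` at the preimage points, and of `ζ j` on the ball
    have hωcd : ContDiff ℝ 1 (curl (u (tt j))) :=
      contDiff_curl (n := 1) ((hsol.contDiff_velocity hmem).of_le (by exact_mod_cast le_top))
    have hωdiff : Differentiable ℝ (curl (u (tt j))) := hωcd.differentiable (by simp)
    have hξcd : ∀ z ∈ closedBall y₀ r,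
        ContDiffAt ℝ 1 (vorticityDirection (curl (u (tt j)))) (xc j + lam j • z) := fun z hz =>
      contDiffAt_vorticityDirection hωcd.contDiffAt (norm_pos_iff.1 (hd.trans (htop z hz)))
    have haffcd : ContDiff ℝ 1 (fun y : EuclideanSpace ℝ (Fin 3) => xc j + lam j • y) :=
      contDiff_const.add (contDiff_id.const_smul _)
    have hζcd : ContDiffOn ℝ 1 (ζ j) (ball y₀ r) := by
      intro z hz
      have h1 := (hξcd z (ball_subset_closedBall hz)).comp z haffcd.contDiffAt
      exact h1.contDiffWithinAt
    -- the chain rule: `‖D(ζ j)(z)‖ₑ ≤ λ_j ‖Dξ(x_j + λ_j z)‖ₑ` on the closed ball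
    have hζder : ∀ z ∈ closedBall y₀ r, HasFDerivAt (ζ j)
        ((fderiv ℝ (vorticityDirection (curl (u (tt j)))) (xc j + lam j • z)).comp
          (lam j • ContinuousLinearMap.id ℝ (EuclideanSpace ℝ (Fin 3)))) z := by
      intro z hz
      have haff : HasFDerivAt (fun y : EuclideanSpace ℝ (Fin 3) => xc j + lam j • y)
          (lam j • ContinuousLinearMap.id ℝ (EuclideanSpace ℝ (Fin 3))) z :=
        ((hasFDerivAt_id z).const_smul (lam j)).const_add (xc j)
      exact ((hξcd z hz).differentiableAt (by simp)).hasFDerivAt.comp z haff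
    have hζbd : ∀ z ∈ closedBall y₀ r, ‖fderiv ℝ (ζ j) z‖ₑ ≤ ENNReal.ofReal (lam j) *
        ‖fderiv ℝ (vorticityDirection (curl (u (tt j)))) (xc j + lam j • z)‖ₑ := by
      intro z hz
      rw [(hζder z hz).fderiv, ← ofReal_norm, ← ofReal_norm,
        ← ENNReal.ofReal_mul (hlam j).le]
      refine ENNReal.ofReal_le_ofReal ((ContinuousLinearMap.opNorm_comp_le _ _).trans ?_)
      rw [mul_comm]
      refine mul_le_mul_of_nonneg_right ?_ (norm_nonneg _)
      rw [norm_smul, Real.norm_of_nonneg (hlam j).le]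
      have := ContinuousLinearMap.norm_id_le (𝕜 := ℝ) (E := EuclideanSpace ℝ (Fin 3))
      nlinarith [(hlam j).le]
    -- the `L^b` norm of `D(ζ j)` over the ball: `≤ λ_j^γ G(tt j) = Q j`
    have hΩmeas : MeasurableSet {x : EuclideanSpace ℝ (Fin 3) | d < ‖curl (u (tt j)) x‖} :=
      (isOpen_lt continuous_const (hωcd.continuous.norm)).measurableSet
    have hLb : eLpNorm (fderiv ℝ (ζ j)) (b : ℝ≥0∞) (volume.restrict (ball y₀ r)) ≤ Q j := by
      rw [eLpNorm_eq_lintegral_rpow_enorm_toReal hbne0 hbtop, hbreal]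
      -- the integral of the `b`-th powers
      have hI1 : ∫⁻ z in ball y₀ r, ‖fderiv ℝ (ζ j) z‖ₑ ^ (b : ℝ) ≤
          ENNReal.ofReal (lam j) ^ (b : ℝ) * (ENNReal.ofReal (lam j ^ 3)⁻¹ *
            ∫⁻ x in {x | d < ‖curl (u (tt j)) x‖},
              ‖fderiv ℝ (vorticityDirection (curl (u (tt j)))) x‖ₑ ^ (b : ℝ)) := by
        calc ∫⁻ z in ball y₀ r, ‖fderiv ℝ (ζ j) z‖ₑ ^ (b : ℝ)
            ≤ ∫⁻ z in ball y₀ r, ENNReal.ofReal (lam j) ^ (b : ℝ) *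
                ‖fderiv ℝ (vorticityDirection (curl (u (tt j)))) (xc j + lam j • z)‖ₑ ^ (b : ℝ) := by
              refine setLIntegral_mono' measurableSet_ball fun z hz => ?_
              rw [← ENNReal.mul_rpow_of_nonneg _ _ hb0.le]
              exact ENNReal.rpow_le_rpow (hζbd z (ball_subset_closedBall hz)) hb0.le
          _ = ENNReal.ofReal (lam j) ^ (b : ℝ) * ∫⁻ z in ball y₀ r,
                ‖fderiv ℝ (vorticityDirection (curl (u (tt j)))) (xc j + lam j • z)‖ₑ ^ (b : ℝ) :=
              lintegral_const_mul' _ _ (ENNReal.rpow_ne_top_of_nonneg hb0.le ENNReal.ofReal_ne_top)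
          _ ≤ _ := by
              refine mul_le_mul' le_rfl ?_
              exact setLIntegral_ball_comp_add_smul_le
                (fun x => ‖fderiv ℝ (vorticityDirection (curl (u (tt j)))) x‖ₑ ^ (b : ℝ)) (hlam j)
                (xc j) y₀ hΩmeas (fun z hz => htop z (ball_subset_closedBall hz))
      -- the top-region integral is `(‖Dξ‖_{L^b(Ω_d)})^b ≤ G(tt j)^b`
      have hI2 : ∫⁻ x in {x | d < ‖curl (u (tt j)) x‖},
          ‖fderiv ℝ (vorticityDirection (curl (u (tt j)))) x‖ₑ ^ (b : ℝ) ≤ G (tt j) ^ (b : ℝ) := by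
        have h := hDξ (tt j) h3
        rw [eLpNorm_eq_lintegral_rpow_enorm_toReal hbne0 hbtop, hbreal] at h
        have h' := ENNReal.rpow_le_rpow h hb0.le
        rwa [← ENNReal.rpow_mul, one_div, inv_mul_cancel₀ hb0.ne', ENNReal.rpow_one] at h'
      -- assemble: `∫ ≤ (Q j)^b`, then take the `1/b`-th power
      have hQb : Q j ^ (b : ℝ) = ENNReal.ofReal (lam j) ^ (b : ℝ) * ENNReal.ofReal (lam j ^ 3)⁻¹ *
          G (tt j) ^ (b : ℝ) := by
        have hreal_id : lam j ^ ((b : ℝ) - 3) = lam j ^ (b : ℝ) * (lam j ^ 3)⁻¹ := by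
          rw [Real.rpow_sub (hlam j), div_eq_mul_inv,
            show ((3 : ℝ)) = ((3 : ℕ) : ℝ) by norm_num, Real.rpow_natCast]
        simp only [hQdef]
        rw [htt j, ENNReal.mul_rpow_of_nonneg _ _ hb0.le]
        congr 1
        rw [ENNReal.ofReal_rpow_of_nonneg (Real.rpow_nonneg (hlam j).le γ) hb0.le,
          ← Real.rpow_mul (hlam j).le, mul_comm γ, hbγ, hreal_id,
          ENNReal.ofReal_mul (Real.rpow_nonneg (hlam j).le _), ENNReal.ofReal_rpow_of_pos (hlam j),
          ENNReal.ofReal_inv_of_pos (pow_pos (hlam j) 3)]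
      have hIQ : ∫⁻ z in ball y₀ r, ‖fderiv ℝ (ζ j) z‖ₑ ^ (b : ℝ) ≤ Q j ^ (b : ℝ) := by
        rw [hQb, mul_assoc]
        exact hI1.trans (mul_le_mul' le_rfl (mul_le_mul' le_rfl hI2))
      calc (∫⁻ z in ball y₀ r, ‖fderiv ℝ (ζ j) z‖ₑ ^ (b : ℝ)) ^ (1 / (b : ℝ))
          ≤ (Q j ^ (b : ℝ)) ^ (1 / (b : ℝ)) := ENNReal.rpow_le_rpow hIQ (by positivity)
        _ = Q j := by rw [one_div, ENNReal.rpow_rpow_inv hb0.ne']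
    -- Morrey on the ball
    have hMy : ‖ζ j y - ζ j y₀‖ₑ ≤ Cm * Q j * ENNReal.ofReal r ^ γ := by
      have h := hMor hζcd hy (mem_ball_self hr)
      refine h.trans ?_
      have hed : edist y y₀ ^ (1 - (Module.finrank ℝ (EuclideanSpace ℝ (Fin 3)) : ℝ) / (b : ℝ)) ≤
          ENNReal.ofReal r ^ γ := by
        rw [finrank_euclideanSpace_fin]
        push_cast
        refine ENNReal.rpow_le_rpow ?_ hγ0.le
        rw [edist_dist]
        exact ENNReal.ofReal_le_ofReal (mem_ball.1 hy).le
      exact mul_le_mul' (mul_le_mul' le_rfl hLb) hed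
    -- the real form with `Q j < η`
    have hfin : Cm * ENNReal.ofReal η * ENNReal.ofReal r ^ γ ≠ ⊤ :=
      ENNReal.mul_ne_top (ENNReal.mul_ne_top hCm.ne ENNReal.ofReal_ne_top)
        (ENNReal.rpow_ne_top_of_nonneg hγ0.le ENNReal.ofReal_ne_top)
    have hMy' : ‖ζ j y - ζ j y₀‖ₑ ≤ Cm * ENNReal.ofReal η * ENNReal.ofReal r ^ γ :=
      hMy.trans (mul_le_mul' (mul_le_mul' le_rfl hQ.le) le_rfl)
    have hreal : (Cm * ENNReal.ofReal η * ENNReal.ofReal r ^ γ).toReal = η * K := by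
      rw [hKdef, mul_assoc, mul_comm (ENNReal.ofReal η), ← mul_assoc, ENNReal.toReal_mul,
        ENNReal.toReal_ofReal hη.le, mul_comm]
    have hfinal := ENNReal.toReal_mono hfin hMy'
    rw [toReal_enorm, hreal] at hfinal
    exact hfinal
  -- the zoomed directions converge to the direction of the limit vorticity on the ball
  have hζlim : ∀ y ∈ closedBall y₀ r, Tendsto (fun j => ζ j y) atTop (𝓝 (‖Ω y‖⁻¹ • Ω y)) := by
    intro y hy
    have hconv : Tendsto (fun j => F j y) atTop (𝓝 (Ω y)) :=
      hflex s₀ hs₀0 (fun _ => s₀) tendsto_const_nhds y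
    have hnd : ContinuousAt (fun v : EuclideanSpace ℝ (Fin 3) => ‖v‖⁻¹ • v) (Ω y) :=
      (continuous_norm.continuousAt.inv₀ (norm_ne_zero_iff.2 (hΩne' y hy))).smul continuousAt_id
    refine (hnd.tendsto.comp hconv).congr fun j => ?_
    show ‖F j y‖⁻¹ • F j y = ζ j y
    simp only [hFdef, hζdef, httdef, vorticityDirection_apply]
    exact inv_norm_smul_smul_of_pos (hc j) _
  -- hence the limit directions agree on the ball
  have hpar : ∀ y ∈ ball y₀ r, ‖Ω y‖⁻¹ • Ω y = ‖Ω y₀‖⁻¹ • Ω y₀ := by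
    intro y hy
    have hy' : y ∈ closedBall y₀ r := ball_subset_closedBall hy
    set D : ℝ := ‖‖Ω y‖⁻¹ • Ω y - ‖Ω y₀‖⁻¹ • Ω y₀‖ with hDdef
    have hDlim : Tendsto (fun j => ‖ζ j y - ζ j y₀‖) atTop (𝓝 D) :=
      ((hζlim y hy').sub (hζlim y₀ (mem_closedBall_self hr.le))).norm
    have hDle : ∀ η : ℝ, 0 < η → D ≤ η * K := fun η hη => by
      by_contra hlt
      have hev : ∀ᶠ j in atTop, η * K < ‖ζ j y - ζ j y₀‖ := hDlim.eventually (lt_mem_nhds (not_le.1 hlt))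
      obtain ⟨j, hj1, hj2, hj3⟩ := ((hfreqQ η hη).and_eventually (hgood.and hev)).exists
      exact absurd (hj2 η hη hj1 y hy) (not_le.2 hj3)
    have hD0 : D ≤ 0 := by
      by_contra hpos
      push Not at hpos
      have e : D / (2 * (K + 1)) * K ≤ D / 2 := by
        rw [div_mul_eq_mul_div, div_le_div_iff₀ (by positivity) (by positivity)]
        nlinarith
      linarith [hDle (D / (2 * (K + 1))) (by positivity)]
    exact sub_eq_zero.1 (norm_eq_zero.1 (le_antisymm hD0 (norm_nonneg _)))
  -- Step 6: `curl W(s₀)` is parallel to `Ω y₀` on the open ball — window rigidity kills `W`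
  have hal : ∀ y ∈ ball y₀ r, cross (curl (W s₀) y) (Ω y₀) = 0 := by
    intro y hy
    have hy' : y ∈ closedBall y₀ r := ball_subset_closedBall hy
    have hΩy : Ω y ≠ 0 := hΩne' y hy'
    have e1 : Ω y = (‖Ω y‖ * ‖Ω y₀‖⁻¹) • Ω y₀ := by
      calc Ω y = ‖Ω y‖ • (‖Ω y‖⁻¹ • Ω y) := by rw [smul_inv_smul₀ (norm_ne_zero_iff.2 hΩy)]
        _ = ‖Ω y‖ • (‖Ω y₀‖⁻¹ • Ω y₀) := by rw [hpar y hy]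
        _ = (‖Ω y‖ * ‖Ω y₀‖⁻¹) • Ω y₀ := by rw [mul_smul]
    show cross (Ω y) (Ω y₀) = 0
    rw [e1]
    ext i
    fin_cases i <;> (simp [cross]; try ring)
  exact hW0 (eq_zero_of_aligned_window hWcl.hasTypeITimeDecay hWcl.continuousOn_uncurry
    (fun s t hst ht' x => hWcl.mild_eq_heatExtension hst ht' x) (fun t ht' => hWcl.isDivFree ht')
    hs₀0 hy₀ isOpen_ball ⟨y₀, mem_ball_self hr⟩ hal (-1) (by norm_num) 0)

/-- **Giga–Miura 2011, Rmk. 2.8 (the scaling-invariant family `∇ζ ∈ L^a(L^b(Ω_d))`,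
`2/a + 3/b = 1`, exponents `2 < a < ∞`, `3 < b < ∞`) — PROVED.** Let `ν > 0`, `T > 0`, and let
`(u, p)` be a classical unforced Navier–Stokes solution on `ℝ³ × [0, T)` which is Leray–Hopf on
`[0, T)` and bounded on `ℝ³ × [0, T']` for every `T' < T`, with a possible blow-up at `T` of Type I
(`IsTypeIBlowup u T`). If for some `d > 0`, some `3 < b < ∞` and `a` with `2/a + 3/b = 1`, the
function `t ↦ ‖∇ξ(t)‖_{L^b(Ω_d(t))}` (`Ω_d(t) = {x : |ω(x,t)| > d}`, `ξ = ω/|ω|`, operator norm of the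
Fréchet derivative, `eLpNorm … b (volume.restrict Ω_d(t))`) admits a measurable majorant `G` with
`∫_{(0,T)} G^a < ∞`, then `u` continues as a classical solution past `T`. The endpoint
`(a, b) = (2, ∞)` is Cor. 2.6 (`hasSmoothExtensionPast_of_directionGradient_sqIntegrable_typeI`).
Printed only as a remark ("It is easy to generalize our assumption in this form with `2/a + 3/b = 1`
and `2 ≤ a < ∞`", HUPS #956 p. 10); proved by the Type-I zoom, Morrey and window rigidity.
[cite: GigaMiura2011, Rmk. 2.8 with Cor. 2.6 / Rmk. 2.7 (§2.1; HUPS preprint #956 pp. 9–10)] -/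
theorem hasSmoothExtensionPast_of_directionGradient_LaLb_typeI {ν T : ℝ} (hν : 0 < ν) (hT : 0 < T)
    {u : ℝ → EuclideanSpace ℝ (Fin 3) → EuclideanSpace ℝ (Fin 3)}
    {p : ℝ → EuclideanSpace ℝ (Fin 3) → ℝ}
    (hsol : IsClassicalNSSolutionOn (Ico 0 T) ν 0 u p) (hLH : IsLerayHopfOn T ν 0 (u 0) u)
    (hbdd : ∀ T' < T, ∃ M : ℝ, ∀ t ∈ Icc 0 T', ∀ x, ‖u t x‖ ≤ M)
    (hI : IsTypeIBlowup u T) {a : ℝ} {b : ℝ≥0} (hb3 : 3 < (b : ℝ)) (hab : 2 / a + 3 / (b : ℝ) = 1)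
    (hD : ∃ d : ℝ, 0 < d ∧ ∃ G : ℝ → ℝ≥0∞, Measurable G ∧ (∫⁻ t in Ioo 0 T, G t ^ a) < ∞ ∧
      ∀ t ∈ Ioo 0 T, eLpNorm (fderiv ℝ (vorticityDirection (curl (u t)))) (b : ℝ≥0∞)
        (volume.restrict {x | d < ‖curl (u t) x‖}) ≤ G t) :
    HasSmoothExtensionPast ν 0 u T := by
  obtain ⟨d, hd, G, hGm, hGa, hDξ⟩ := hD
  by_contra hext
  exact false_of_directionGradient_LaLb_typeI hν hT hsol hLH hbdd hI hext hd hb3 hab hGm hGa hDξ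

end Summit.NavierStokesRegularity.NavierStokesRegularity.Theorems

end
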